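import Literature.NumberTheory.Transcendental.QuadraticRelationsLogarithmsSec6Fun
import HarnessLib

/-!
# Roy–Waldschmidt 1997, §5: the elementary reductions in the proof of Théorème 5.1

D. Roy, M. Waldschmidt, Ann. Sci. ÉNS (4) 30 (1997) 753–796, proof of Théorème 5.1, p. 780:
"On peut aussi supposer `d > 2n > 0`, `n ≥ d₀` et `d₁ > 0`. En effet, si `n < d₀`, alors `W` et `Y`
sont contenus dans `T_L(ℂ)` où `L` est un sous-groupe algébrique de `G` défini sur `K` de la forme
`L₀ × G₁` avec `L₀ ≠ G₀`. Pour ce choix de `L`, le théorème 5.1 est vérifié car les entiers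
`d₁', ℓ₀', λ'` et `λ_a'` sont nuls et l'inégalité (5.1) se résume à `0 ≤ (1-ε)d₁d₀'`. Cela permet de
supposer `n ≥ d₀`. Si `n = 0` ou si `d ≤ 2n`, le théorème 5.1 est vérifié avec `L` réduit à
l'élément neutre … trois cas … Alors, on a aussi `d₁ > 0`. On observe encore que si
`Y ⊆ T_{G₀×1}(ℂ)`, alors le théorème 5.1 est vérifié avec `L = G₀ × {1}` …".

* `RoyWaldschmidt1997.h51_of_generic` — **the conclusion of Théorème 5.1** (in the tangent-space
  form `h51` of `…Sec6IVa.lean`: `∃ d₀' d₁' g, …, (5.1)`) **holds for an object `X` with `d > 0`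
  as soon as it holds under the additional hypotheses `d > 2n > 0`, `n ≥ d₀`, `d₁ > 0` and
  `Y ⊄ ℂ^{d₀} × 0`** — the four degenerate cases being settled here exactly as printed
  (`L = L₀ × G₁`: `g = ` (quotient of `ℂ^{d₀}` by `π₀(ℂW + ℂY)`) `× 0`; `L = {e}`: `g = id`;
  `L = G₀ × {1}`: `g = 0 × id`).  This is PROVED; it also checks the shape of the rendering of
  (5.1) in the degenerate cases.

No definitions, no named facts.

## References

* [RoyWaldschmidt1997ENS] D. Roy, M. Waldschmidt, Ann. Sci. ÉNS (4) 30 (1997) 753–796, proof of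
  Théorème 5.1, p. 780 (read on the rendered scan).
-/

noncomputable section

open Complex IntermediateField Module Submodule

namespace Literature.NumberTheory.Transcendental

namespace RoyWaldschmidt1997

open LiePresentation

variable {K : IntermediateField ℚ ℂ}

/-! ### `λ_a ≤ λ` -/

/-- `rang Γ_a ≤ rang Γ`, i.e. `ℓ_a - κ_a ≤ ℓ₁ - κ` (`Γ_a = exp_G Y_a ⊆ Γ = exp_G Y`). [folklore] -/
theorem RWObj.lamA_le_lam (X : RWObj K) : X.ellA - X.kapA ≤ X.ell₁ - X.kap := by
  classical
  let ψ : ((Fin X.d₀ → ℂ) × (Fin X.d₁ → ℂ)) →ₗ[ℤ]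
      ((Fin X.d₀ → ℂ) × (Fin X.d₁ → ℂ)) ⧸ (omegaLattice X.d₀ X.d₁).toAddSubgroup :=
    (QuotientAddGroup.mk' (omegaLattice X.d₀ X.d₁).toAddSubgroup).toIntLinearMap
  have hker : LinearMap.ker ψ = omegaLattice X.d₀ X.d₁ := by
    ext v
    rw [LinearMap.mem_ker]
    show (QuotientAddGroup.mk' (omegaLattice X.d₀ X.d₁).toAddSubgroup) v = 0 ↔ _
    rw [QuotientAddGroup.mk'_apply, QuotientAddGroup.eq_zero_iff]
    rfl
  have hY := finrank_map_add_finrank_inf_ker_int X.Y X.hYfg ψ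
  have hYa := finrank_map_add_finrank_inf_ker_int X.Ya X.fg_Ya ψ
  rw [hker] at hY hYa
  have hle : Module.finrank ℤ ↥(X.Ya.map ψ) ≤ Module.finrank ℤ ↥(X.Y.map ψ) :=
    finrank_le_of_le_fg (Submodule.map_mono X.hYa) (X.hYfg.map _)
  simp only [RWObj.ellA, RWObj.kapA, RWObj.ell₁, RWObj.kap]
  omega

/-! ### The numerical checks for `L = {e}` (p. 780, "trois cas") -/

/-- Bounds from `ε ≤ (2d(d+λ)+1)⁻¹`: `εd ≤ 1/2`, `εd(d+λ) < 1/2`, `ε ≤ 1`, and `ε²λ_a ≤ ε/2` when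
`λ_a ≤ λ`. [folklore] -/
theorem eps_bounds {d lam lamA ε : ℝ} (hd : 1 ≤ d) (hlam : 0 ≤ lam) (hle : lamA ≤ lam)
    (hε0 : 0 < ε) (hε : ε ≤ 1 / (2 * d * (d + lam) + 1)) :
    ε * d ≤ 1 / 2 ∧ ε * (d * (d + lam)) < 1 / 2 ∧ ε ≤ 1 ∧ ε ^ 2 * lamA ≤ ε / 2 := by
  have hD : 0 < 2 * d * (d + lam) + 1 := by positivity
  have h1 : ε * (2 * d * (d + lam) + 1) ≤ 1 := by
    rw [le_div_iff₀ hD] at hε; exact hε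
  refine ⟨?_, ?_, ?_, ?_⟩
  · nlinarith [mul_nonneg hε0.le hlam, mul_nonneg (mul_nonneg hε0.le (by linarith : (0:ℝ) ≤ d)) hlam]
  · nlinarith
  · nlinarith [mul_nonneg (by linarith : (0:ℝ) ≤ d) hlam]
  · -- `ε lam ≤ 1/(2d) ≤ 1/2`
    have h2 : ε * lam ≤ 1 / 2 := by nlinarith [mul_nonneg (by linarith : (0:ℝ) ≤ d) hlam]
    nlinarith [mul_le_mul_of_nonneg_left hle (sq_nonneg ε), mul_nonneg hε0.le hε0.le]

/-- (5.1) for `L = {e}` when `d < 2n`: the left side is `≤ 0`, the right side `≥ εd₁(d₁ - 1/2) ≥ 0`.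
[cite: RoyWaldschmidt1997ENS, proof of Théorème 5.1, p. 780] -/
theorem ineq_id_of_lt {d₀ d₁ n ℓ₀ lam lamA ε : ℝ} (hd : 1 ≤ d₀ + d₁) (hd₀ : 0 ≤ d₀) (hd₁ : 0 ≤ d₁)
    (hd₁Z : d₁ = 0 ∨ 1 ≤ d₁) (hn : n ≤ d₀ + d₁) (hlt : d₀ + d₁ - 2 * n ≤ -1) (hℓ₀n : ℓ₀ ≤ n)
    (hlam : 0 ≤ lam) (hle : lamA ≤ lam)
    (hε0 : 0 < ε) (hε : ε ≤ 1 / (2 * (d₀ + d₁) * ((d₀ + d₁) + lam) + 1)) :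
    (((d₀ + d₁) - 2 * n) + ε * (n - d₀)) * (d₁ + lam) ≤
      d₁ * ((((d₀ + d₁)) - ℓ₀) + ε * (ℓ₀ - d₀) - ε ^ 2 * lamA) := by
  obtain ⟨h1, -, h3, h4⟩ := eps_bounds hd hlam hle hε0 hε
  have hF : ((d₀ + d₁) - 2 * n) + ε * (n - d₀) ≤ 0 := by nlinarith [mul_nonneg hε0.le hd₀]
  have hL : (((d₀ + d₁) - 2 * n) + ε * (n - d₀)) * (d₁ + lam) ≤ 0 :=
    mul_nonpos_of_nonpos_of_nonneg hF (by linarith)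
  have hR : 0 ≤ d₁ * ((((d₀ + d₁)) - ℓ₀) + ε * (ℓ₀ - d₀) - ε ^ 2 * lamA) := by
    rcases hd₁Z with h0 | h0
    · rw [h0]; simp
    · refine mul_nonneg hd₁ ?_
      -- `(1-ε)(d-ℓ₀) + εd₁ - ε²λ_a ≥ ε(d₁ - 1/2) ≥ 0`
      nlinarith [mul_nonneg (by linarith : (0:ℝ) ≤ 1 - ε) (by linarith : (0:ℝ) ≤ d₀ + d₁ - ℓ₀)]
  linarith

/-- (5.1) for `L = {e}` when `d = 2n > 0` (then `d₁ > 0`): the left side is `< 1/2`, the right side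
`≥ d₁ n/2 ≥ 1/2`. [cite: RoyWaldschmidt1997ENS, proof of Théorème 5.1, p. 780] -/
theorem ineq_id_of_eq {d₀ d₁ n ℓ₀ lam lamA ε : ℝ} (hd₀ : 0 ≤ d₀) (hd₁ : 1 ≤ d₁) (hn1 : 1 ≤ n)
    (heq : d₀ + d₁ = 2 * n) (hℓ₀ : 0 ≤ ℓ₀) (hℓ₀n : ℓ₀ ≤ n)
    (hlam : 0 ≤ lam) (hle : lamA ≤ lam)
    (hε0 : 0 < ε) (hε : ε ≤ 1 / (2 * (d₀ + d₁) * ((d₀ + d₁) + lam) + 1)) :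
    (((d₀ + d₁) - 2 * n) + ε * (n - d₀)) * (d₁ + lam) ≤
      d₁ * ((((d₀ + d₁)) - ℓ₀) + ε * (ℓ₀ - d₀) - ε ^ 2 * lamA) := by
  obtain ⟨h1, h2, h3, h4⟩ := eps_bounds (by linarith) hlam hle hε0 hε
  -- left side `= ε(n-d₀)(d₁+λ) ≤ ε d (d+λ) < 1/2`
  have hL : (((d₀ + d₁) - 2 * n) + ε * (n - d₀)) * (d₁ + lam) ≤ 1 / 2 := by
    have : (((d₀ + d₁) - 2 * n) + ε * (n - d₀)) * (d₁ + lam) = ε * ((n - d₀) * (d₁ + lam)) := by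
      rw [heq]; ring
    rw [this]
    have hb : (n - d₀) * (d₁ + lam) ≤ (d₀ + d₁) * ((d₀ + d₁) + lam) := by nlinarith
    nlinarith [mul_le_mul_of_nonneg_left hb hε0.le]
  -- right side `≥ d₁ (n - 1/2 - ...)`: `(1-ε)(d-ℓ₀) ≥ (1-ε) n`, `εd ≤ 1/2`, `ε²λ_a ≤ ε/2 ≤ 1/4`
  have hR : 1 / 2 ≤ d₁ * ((((d₀ + d₁)) - ℓ₀) + ε * (ℓ₀ - d₀) - ε ^ 2 * lamA) := by
    have hin : 1 / 2 ≤ (((d₀ + d₁)) - ℓ₀) + ε * (ℓ₀ - d₀) - ε ^ 2 * lamA := by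
      have hεn : ε * n ≤ 1 / 4 := by nlinarith
      have hε4 : ε ≤ 1 / 4 := by nlinarith
      nlinarith [mul_nonneg hε0.le hℓ₀]
    nlinarith
  linarith

/-! ### The reductions -/

set_option maxHeartbeats 1600000 in
/-- **The elementary reductions in the proof of Théorème 5.1** (Roy–Waldschmidt 1997, p. 780): the
conclusion of Théorème 5.1 for `X = (d₀, d₁, W, Y, Y_a)` with `d > 0` — in the tangent-space form
`h51` of `…Sec6IVa.lean` — holds provided it holds under the additional hypotheses `d > 2n > 0`,
`n ≥ d₀`, `d₁ > 0`, `Y ⊄ ℂ^{d₀} × 0`: if `n < d₀` take `L = L₀ × G₁`, `T_{L₀} = π₀(ℂW + ℂY)`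
(`d₁' = ℓ₀' = λ' = λ_a' = 0`, (5.1) reads `0 ≤ (1-ε)d₁d₀'`); if `n = 0` or `d ≤ 2n` take `L = {e}`
(three numerical cases); if `Y ⊆ T_{G₀×1}(ℂ)` take `L = G₀ × {1}` (`λ' = λ_a' = d₀' = 0`, `d₁' = d₁`,
`ℓ₀' ≤ n`, `d₀ ≤ n`). [cite: RoyWaldschmidt1997ENS, proof of Théorème 5.1, p. 780] -/
theorem h51_of_generic (X : RWObj K) (hd : 0 < X.d₀ + X.d₁)
    (hgen : 2 * X.nn < X.d₀ + X.d₁ → 0 < X.nn → X.d₀ ≤ X.nn → 0 < X.d₁ → (∃ y ∈ X.Y, y.2 ≠ 0) →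
    ∃ (d₀' d₁' : ℕ) (g : ((Fin X.d₀ → ℂ) × (Fin X.d₁ → ℂ)) →ₗ[ℂ] ((Fin d₀' → ℂ) × (Fin d₁' → ℂ))),
      IsStruct K g ∧ Function.Surjective g ∧
      (∀ z : Fin X.d₁ → ℤ, ∃ z' : Fin d₁' → ℤ, g (0, fun j => (z j : ℂ)) = (0, fun j => (z' j : ℂ))) ∧
      0 < d₀' + d₁' ∧
      ∀ ε : ℝ, 0 < ε → ε ≤ 1 / (2 * ((X.d₀ : ℝ) + X.d₁) * (((X.d₀ : ℝ) + X.d₁) + ((X.ell₁ : ℝ) - X.kap)) + 1) →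
        ((((X.d₀ : ℝ) + X.d₁) - 2 * X.nn) + ε * ((X.nn : ℝ) - X.d₀)) *
            ((d₁' : ℝ) + ((Module.finrank ℤ ↥(X.Y.map (g.restrictScalars ℤ)) : ℝ) -
              Module.finrank ℤ ↥(X.Y.map (g.restrictScalars ℤ) ⊓ omegaLattice d₀' d₁'))) ≤
          (X.d₁ : ℝ) * ((((d₀' : ℝ) + d₁') - Module.finrank K ↥(X.W.map (g.restrictScalars K))) +
            ε * ((Module.finrank K ↥(X.W.map (g.restrictScalars K)) : ℝ) - d₀') -
            ε ^ 2 * ((Module.finrank ℤ ↥(X.Ya.map (g.restrictScalars ℤ)) : ℝ) -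
              Module.finrank ℤ ↥(X.Ya.map (g.restrictScalars ℤ) ⊓ omegaLattice d₀' d₁')))) :
    ∃ (d₀' d₁' : ℕ) (g : ((Fin X.d₀ → ℂ) × (Fin X.d₁ → ℂ)) →ₗ[ℂ] ((Fin d₀' → ℂ) × (Fin d₁' → ℂ))),
      IsStruct K g ∧ Function.Surjective g ∧
      (∀ z : Fin X.d₁ → ℤ, ∃ z' : Fin d₁' → ℤ, g (0, fun j => (z j : ℂ)) = (0, fun j => (z' j : ℂ))) ∧
      0 < d₀' + d₁' ∧
      ∀ ε : ℝ, 0 < ε → ε ≤ 1 / (2 * ((X.d₀ : ℝ) + X.d₁) * (((X.d₀ : ℝ) + X.d₁) + ((X.ell₁ : ℝ) - X.kap)) + 1) →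
        ((((X.d₀ : ℝ) + X.d₁) - 2 * X.nn) + ε * ((X.nn : ℝ) - X.d₀)) *
            ((d₁' : ℝ) + ((Module.finrank ℤ ↥(X.Y.map (g.restrictScalars ℤ)) : ℝ) -
              Module.finrank ℤ ↥(X.Y.map (g.restrictScalars ℤ) ⊓ omegaLattice d₀' d₁'))) ≤
          (X.d₁ : ℝ) * ((((d₀' : ℝ) + d₁') - Module.finrank K ↥(X.W.map (g.restrictScalars K))) +
            ε * ((Module.finrank K ↥(X.W.map (g.restrictScalars K)) : ℝ) - d₀') -
            ε ^ 2 * ((Module.finrank ℤ ↥(X.Ya.map (g.restrictScalars ℤ)) : ℝ) -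
              Module.finrank ℤ ↥(X.Ya.map (g.restrictScalars ℤ) ⊓ omegaLattice d₀' d₁'))) := by
  classical
  have hlam0 : (X.kap : ℝ) ≤ X.ell₁ := by exact_mod_cast X.kap_le_ell₁
  -- Case `n < d₀`: `L = L₀ × G₁`
  by_cases hA : X.nn < X.d₀
  · set S := span ℂ ((X.W : Set ((Fin X.d₀ → ℂ) × (Fin X.d₁ → ℂ))) ∪ (X.Y : Set _)) with hS
    set T₀ : Submodule ℂ (Fin X.d₀ → ℂ) := S.map (LinearMap.fst ℂ _ _) with hT₀
    have hT₀K : IsKRational K T₀ := by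
      refine ⟨{c | ofK K (L := ℂ) c ∈ T₀}, le_antisymm ?_ (span_le.mpr (by rintro _ ⟨c, hc, rfl⟩; exact hc))⟩
      rw [hT₀, hS, Submodule.map_span]
      refine span_le.mpr ?_
      rintro _ ⟨p, hp, rfl⟩
      have hp1 : ∀ i, p.1 i ∈ K := by
        rcases hp with hp | hp
        · exact (X.hW p hp).1
        · exact (X.hY p hp).1
      obtain ⟨c, hc⟩ := exists_ofK_of_mem K hp1
      refine subset_span ⟨c, ?_, hc.symm⟩
      simp only [Set.mem_setOf_eq]
      rw [← hc]
      exact subset_span ⟨p, hp, rfl⟩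
    have hdimT₀ : Module.finrank ℂ T₀ ≤ X.nn := Submodule.finrank_map_le _ _
    obtain ⟨e, g₀, g₀K, hg₀surj, hg₀ker, hg₀K, hdim⟩ := exists_kQuot K T₀ hT₀K
    -- `g = g₀ × 0 : ℂ^{d₀} × ℂ^{d₁} → ℂ^{e} × ℂ^{0}`
    let g : ((Fin X.d₀ → ℂ) × (Fin X.d₁ → ℂ)) →ₗ[ℂ] ((Fin e → ℂ) × (Fin 0 → ℂ)) :=
      LinearMap.prod (g₀.comp (LinearMap.fst ℂ _ _)) 0
    have hgap : ∀ p, g p = (g₀ p.1, (0 : (Fin X.d₁ → ℂ) →ₗ[ℂ] (Fin 0 → ℂ)) p.2) := fun p => rfl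
    have hstruct : IsStruct K g :=
      isStruct_of_block g g₀ 0 hgap (fun c => ⟨g₀K c, hg₀K c⟩) (fun q => ⟨finZeroElim, funext finZeroElim⟩)
    have hsurj : Function.Surjective g := by
      rintro ⟨u, v⟩
      obtain ⟨u', rfl⟩ := hg₀surj u
      exact ⟨(u', 0), Prod.ext rfl (funext finZeroElim)⟩
    have hker : ∀ p ∈ S, g p = 0 := by
      intro p hp
      rw [hgap, Prod.mk_eq_zero]
      refine ⟨?_, funext finZeroElim⟩
      rw [← LinearMap.mem_ker, hg₀ker, hT₀]
      exact ⟨p, hp, rfl⟩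
    have hWbot : X.W.map (g.restrictScalars K) = ⊥ := by
      rw [eq_bot_iff]; rintro _ ⟨w, hw, rfl⟩
      exact (Submodule.mem_bot _).mpr (hker w (subset_span (Or.inl hw)))
    have hYbot : X.Y.map (g.restrictScalars ℤ) = ⊥ := by
      rw [eq_bot_iff]; rintro _ ⟨y, hy, rfl⟩
      exact (Submodule.mem_bot _).mpr (hker y (subset_span (Or.inr hy)))
    have hYabot : X.Ya.map (g.restrictScalars ℤ) = ⊥ := by
      rw [eq_bot_iff]; rintro _ ⟨y, hy, rfl⟩
      exact (Submodule.mem_bot _).mpr (hker y (subset_span (Or.inr (X.hYa hy))))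
    have hdpos' : 0 < e + 0 := by omega
    refine ⟨e, 0, g, hstruct, hsurj, fun z => ⟨finZeroElim, ?_⟩, hdpos', fun ε hε0 hε => ?_⟩
    · rw [hgap]
      exact Prod.ext (by simp) (funext finZeroElim)
    · have h1 : Module.finrank ℤ ↥(X.Y.map (g.restrictScalars ℤ) ⊓ omegaLattice e 0) = 0 := by
        rw [show X.Y.map (g.restrictScalars ℤ) ⊓ omegaLattice e 0 = ⊥ from
          le_bot_iff.mp (inf_le_left.trans hYbot.le), finrank_bot]
      have h2 : Module.finrank ℤ ↥(X.Ya.map (g.restrictScalars ℤ) ⊓ omegaLattice e 0) = 0 := by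
        rw [show X.Ya.map (g.restrictScalars ℤ) ⊓ omegaLattice e 0 = ⊥ from
          le_bot_iff.mp (inf_le_left.trans hYabot.le), finrank_bot]
      have h3 : Module.finrank ℤ ↥(X.Y.map (g.restrictScalars ℤ)) = 0 := by rw [hYbot, finrank_bot]
      have h4 : Module.finrank ℤ ↥(X.Ya.map (g.restrictScalars ℤ)) = 0 := by rw [hYabot, finrank_bot]
      have h5 : Module.finrank K ↥(X.W.map (g.restrictScalars K)) = 0 := by rw [hWbot, finrank_bot]
      rw [h1, h2, h3, h4, h5]
      simp only [sub_zero, add_zero, CharP.cast_eq_zero]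
      have hε1 : ε ≤ 1 := by
        have hD : (1 : ℝ) ≤ 2 * ((X.d₀ : ℝ) + X.d₁) * (((X.d₀ : ℝ) + X.d₁) + ((X.ell₁ : ℝ) - X.kap)) + 1 := by
          have : (0 : ℝ) ≤ 2 * ((X.d₀ : ℝ) + X.d₁) * (((X.d₀ : ℝ) + X.d₁) + ((X.ell₁ : ℝ) - X.kap)) := by
            have : (0 : ℝ) ≤ (X.ell₁ : ℝ) - X.kap := by linarith
            positivity
          linarith
        calc ε ≤ _ := hε
          _ ≤ 1 := by rw [div_le_one (by linarith)]; exact hD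
      have he : (0 : ℝ) ≤ e := Nat.cast_nonneg _
      have hd1 : (0 : ℝ) ≤ X.d₁ := Nat.cast_nonneg _
      nlinarith [mul_nonneg hd1 he, mul_nonneg (mul_nonneg hd1 he) (by linarith : (0:ℝ) ≤ 1 - ε)]
  push Not at hA
  -- Case `n = 0` or `d ≤ 2n`: `L = {e}`, `g = id`
  by_cases hB : X.nn = 0 ∨ X.d₀ + X.d₁ ≤ 2 * X.nn
  · have hstruct : IsStruct K (LinearMap.id : ((Fin X.d₀ → ℂ) × (Fin X.d₁ → ℂ)) →ₗ[ℂ] _) :=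
      ⟨fun c => ⟨c, rfl⟩, fun q => ⟨q, rfl⟩⟩
    have hWid : X.W.map ((LinearMap.id : ((Fin X.d₀ → ℂ) × (Fin X.d₁ → ℂ)) →ₗ[ℂ] _).restrictScalars K) = X.W := by
      ext w; simp
    have hYid : X.Y.map ((LinearMap.id : ((Fin X.d₀ → ℂ) × (Fin X.d₁ → ℂ)) →ₗ[ℂ] _).restrictScalars ℤ) = X.Y := by
      ext y; simp
    have hYaid : X.Ya.map ((LinearMap.id : ((Fin X.d₀ → ℂ) × (Fin X.d₁ → ℂ)) →ₗ[ℂ] _).restrictScalars ℤ) = X.Ya := by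
      ext y; simp
    refine ⟨X.d₀, X.d₁, LinearMap.id, hstruct, Function.surjective_id, fun z => ⟨z, rfl⟩, hd, fun ε hε0 hε => ?_⟩
    rw [hWid, hYid, hYaid]
    change ((((X.d₀ : ℝ) + X.d₁) - 2 * X.nn) + ε * ((X.nn : ℝ) - X.d₀)) * ((X.d₁ : ℝ) + ((X.ell₁ : ℝ) - X.kap)) ≤
      (X.d₁ : ℝ) * ((((X.d₀ : ℝ) + X.d₁) - X.ell₀) + ε * ((X.ell₀ : ℝ) - X.d₀) - ε ^ 2 * ((X.ellA : ℝ) - X.kapA))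
    have hℓ₀n : (X.ell₀ : ℝ) ≤ X.nn := by exact_mod_cast X.ell₀_le_nn
    have hnd : (X.nn : ℝ) ≤ X.d₀ + X.d₁ := by have := X.nn_le_dd; simp only [RWObj.dd] at this; exact_mod_cast this
    have hκa : (X.kapA : ℝ) ≤ X.ellA := by
      have : X.kapA ≤ X.ellA := finrank_le_of_le_fg inf_le_left X.fg_Ya
      exact_mod_cast this
    have hle : (X.ellA : ℝ) - X.kapA ≤ (X.ell₁ : ℝ) - X.kap := by
      have h1 := X.lamA_le_lam
      have h2 := X.kap_le_ell₁
      have h3 : X.kapA ≤ X.ellA := finrank_le_of_le_fg inf_le_left X.fg_Ya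
      have : X.ellA + X.kap ≤ X.ell₁ + X.kapA := by omega
      have : ((X.ellA + X.kap : ℕ) : ℝ) ≤ ((X.ell₁ + X.kapA : ℕ) : ℝ) := by exact_mod_cast this
      push_cast at this; linarith
    have hd₀n : (X.d₀ : ℝ) ≤ X.nn := by exact_mod_cast hA
    rcases hB with hn0 | hle2
    · -- `n = 0`: `W = 0`, `Y = 0`, `d₀ = 0`; both sides equal `d₁²`
      have h1 := X.ell₁_eq_zero_of_nn hn0
      have h2 := X.ellA_eq_zero_of_nn hn0
      have h3 := X.kapA_eq_zero_of_nn hn0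
      have h4 : X.kap = 0 := by have := X.kap_le_ell₁; omega
      have h5 : X.ell₀ = 0 := by have := X.ell₀_le_nn; omega
      have h6 : X.d₀ = 0 := by omega
      rw [hn0, h1, h2, h3, h4, h5, h6]
      simp only [Nat.cast_zero, sub_zero, zero_add, mul_zero, add_zero, sub_self]
      nlinarith
    · rcases Nat.lt_or_ge (2 * X.nn) (X.d₀ + X.d₁ + 1) with hlt | hlt
      · -- `d = 2n`
        have heq : X.d₀ + X.d₁ = 2 * X.nn := by omega
        have hn1 : 1 ≤ X.nn := by omega
        have hd₁ : 1 ≤ X.d₁ := by omega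
        exact ineq_id_of_eq (Nat.cast_nonneg _) (by exact_mod_cast hd₁) (by exact_mod_cast hn1)
          (by exact_mod_cast heq) (Nat.cast_nonneg _) hℓ₀n (by linarith) hle hε0 hε
      · -- `d < 2n`
        have hlt' : ((X.d₀ : ℝ) + X.d₁) - 2 * X.nn ≤ -1 := by
          have : X.d₀ + X.d₁ + 1 ≤ 2 * X.nn := hlt
          have : ((X.d₀ + X.d₁ + 1 : ℕ) : ℝ) ≤ ((2 * X.nn : ℕ) : ℝ) := by exact_mod_cast this
          push_cast at this; linarith
        have hd₁Z : (X.d₁ : ℝ) = 0 ∨ 1 ≤ (X.d₁ : ℝ) := by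
          rcases Nat.eq_zero_or_pos X.d₁ with h | h
          · exact Or.inl (by exact_mod_cast h)
          · exact Or.inr (by exact_mod_cast h)
        exact ineq_id_of_lt (by exact_mod_cast hd) (Nat.cast_nonneg _) (Nat.cast_nonneg _) hd₁Z hnd hlt'
          hℓ₀n (by linarith) hle hε0 hε
  push Not at hB
  obtain ⟨hn0, h2n⟩ := hB
  have hnpos : 0 < X.nn := Nat.pos_of_ne_zero hn0
  have hd₁pos : 0 < X.d₁ := by omega
  -- Case `Y ⊆ ℂ^{d₀} × 0`: `L = G₀ × {1}`, `g = 0 × id`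
  by_cases hC : ∀ y ∈ X.Y, y.2 = 0
  · let g : ((Fin X.d₀ → ℂ) × (Fin X.d₁ → ℂ)) →ₗ[ℂ] ((Fin 0 → ℂ) × (Fin X.d₁ → ℂ)) :=
      LinearMap.prod 0 (LinearMap.snd ℂ _ _)
    have hgap : ∀ p, g p = ((0 : (Fin X.d₀ → ℂ) →ₗ[ℂ] (Fin 0 → ℂ)) p.1,
        (LinearMap.id : (Fin X.d₁ → ℂ) →ₗ[ℂ] (Fin X.d₁ → ℂ)) p.2) := fun p => rfl
    have hstruct : IsStruct K g :=
      isStruct_of_block g 0 LinearMap.id hgap (fun c => ⟨finZeroElim, funext finZeroElim⟩) (fun q => ⟨q, rfl⟩)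
    have hsurj : Function.Surjective g := by
      rintro ⟨u, v⟩
      exact ⟨(0, v), Prod.ext (funext finZeroElim) rfl⟩
    have hYbot : X.Y.map (g.restrictScalars ℤ) = ⊥ := by
      rw [eq_bot_iff]; rintro _ ⟨y, hy, rfl⟩
      refine (Submodule.mem_bot _).mpr ?_
      show g y = 0
      rw [hgap, Prod.mk_eq_zero]
      exact ⟨funext finZeroElim, by rw [LinearMap.id_apply]; exact hC y hy⟩
    have hYabot : X.Ya.map (g.restrictScalars ℤ) = ⊥ := by
      rw [eq_bot_iff]; rintro _ ⟨y, hy, rfl⟩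
      refine (Submodule.mem_bot _).mpr ?_
      show g y = 0
      rw [hgap, Prod.mk_eq_zero]
      exact ⟨funext finZeroElim, by rw [LinearMap.id_apply]; exact hC y (X.hYa hy)⟩
    haveI : Module.Finite K X.W := X.finite_W
    have hℓ₀' : Module.finrank K ↥(X.W.map (g.restrictScalars K)) ≤ X.nn :=
      (Submodule.finrank_map_le _ _).trans X.ell₀_le_nn
    refine ⟨0, X.d₁, g, hstruct, hsurj, fun z => ⟨z, Prod.ext (funext finZeroElim) rfl⟩, by omega,
      fun ε hε0 hε => ?_⟩
    have h1 : Module.finrank ℤ ↥(X.Y.map (g.restrictScalars ℤ) ⊓ omegaLattice 0 X.d₁) = 0 := by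
      rw [show X.Y.map (g.restrictScalars ℤ) ⊓ omegaLattice 0 X.d₁ = ⊥ from
        le_bot_iff.mp (inf_le_left.trans hYbot.le), finrank_bot]
    have h2 : Module.finrank ℤ ↥(X.Ya.map (g.restrictScalars ℤ) ⊓ omegaLattice 0 X.d₁) = 0 := by
      rw [show X.Ya.map (g.restrictScalars ℤ) ⊓ omegaLattice 0 X.d₁ = ⊥ from
        le_bot_iff.mp (inf_le_left.trans hYabot.le), finrank_bot]
    have h3 : Module.finrank ℤ ↥(X.Y.map (g.restrictScalars ℤ)) = 0 := by rw [hYbot, finrank_bot]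
    have h4 : Module.finrank ℤ ↥(X.Ya.map (g.restrictScalars ℤ)) = 0 := by rw [hYabot, finrank_bot]
    rw [h1, h2, h3, h4]
    simp only [Nat.cast_zero, sub_zero, zero_add]
    have hε1 : ε ≤ 1 := by
      have hD : (1 : ℝ) ≤ 2 * ((X.d₀ : ℝ) + X.d₁) * (((X.d₀ : ℝ) + X.d₁) + ((X.ell₁ : ℝ) - X.kap)) + 1 := by
        have : (0 : ℝ) ≤ 2 * ((X.d₀ : ℝ) + X.d₁) * (((X.d₀ : ℝ) + X.d₁) + ((X.ell₁ : ℝ) - X.kap)) := by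
          have : (0 : ℝ) ≤ (X.ell₁ : ℝ) - X.kap := by linarith
          positivity
        linarith
      calc ε ≤ _ := hε
        _ ≤ 1 := by rw [div_le_one (by linarith)]; exact hD
    have hl : (Module.finrank K ↥(X.W.map (g.restrictScalars K)) : ℝ) ≤ X.nn := by exact_mod_cast hℓ₀'
    have hd₀n : (X.d₀ : ℝ) ≤ X.nn := by exact_mod_cast hA
    have hd1 : (0 : ℝ) ≤ X.d₁ := Nat.cast_nonneg _
    -- `d₁ F ≤ d₁ (d₁ - ℓ₀'(1-ε))` with `F = (d₁-n) + (d₀-n)(1-ε) ≤ d₁ - n ≤ d₁ - ℓ₀'(1-ε)`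
    have key : (((X.d₀ : ℝ) + X.d₁) - 2 * X.nn) + ε * ((X.nn : ℝ) - X.d₀) ≤
        ((X.d₁ : ℝ) - Module.finrank K ↥(X.W.map (g.restrictScalars K))) +
          ε * (Module.finrank K ↥(X.W.map (g.restrictScalars K)) : ℝ) := by
      nlinarith [mul_nonneg (by linarith : (0:ℝ) ≤ 1 - ε) (by linarith : (0:ℝ) ≤ (X.nn : ℝ) - X.d₀),
        mul_nonneg (by linarith : (0:ℝ) ≤ 1 - ε) (by linarith : (0:ℝ) ≤ (X.nn : ℝ) - Module.finrank K ↥(X.W.map (g.restrictScalars K)))]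
    nlinarith [mul_le_mul_of_nonneg_left key hd1]
  -- the generic case
  push Not at hC
  obtain ⟨y, hy, hy2⟩ := hC
  exact hgen h2n hnpos hA hd₁pos ⟨y, hy, hy2⟩

end RoyWaldschmidt1997

end Literature.NumberTheory.Transcendental
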